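import Summits.CriticalPhenomena.CardyFormulaZ2.Theorems.CardySusyWardParafermionFamiliesToSLESixAnchorDataLattice
import Summits.CriticalPhenomena.CardyFormulaZ2.Theorems.CardySusyWardParafermionFamiliesToSLESixAnchoredWallFlux

/-!
# The concrete anchor family (skeleton r4 of line `strip-anchored-vertex-normalisation`,
# crux stmt-CriticalPhenomena-10814), IV: the ABSOLUTE phases of the free-wall flux corners

Registered sub-goal `stub_anchorFreePhase` of the stub `stub_anchorMoment_of_IP`. For the concrete anchor
data `E = anchorData δ` (`…AnchorDefs.lean`) at level `L` (`L δ < 2 ≤ (L + 1) δ`; discrete free arc `B` =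
the free window `{L - 1 ≤ s ≤ L, |d| ≤ L - 3}`, wired arc `A` = the rest of the discrete boundary, `A`–`B`
edges `e₁ = s((L-2,1),(L-1,1))`, `e₂ = s((1,L-2),(1,L-1))`, `…AnchorDataLattice.lean`; `s = v₀ + v₁`,
`d = v₀ - v₁`), every free-wall site `w` (level `L - 2`, `|d| ≤ L - 4`) has its two flux corners equal to
`G(w, w - e₀) = sixthPhase (-1) · P(w ↔ A)` and `G(w, w - e₁) = sixthPhase (-3) · P(w ↔ A)` — S5's wall
package `S5.wall_phase_package` with the ABSOLUTE turn count `τ = -2`, on the FULL free side.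

* `startCorner_eq`: the start corner of `anchorData δ` is `((L-1,1), 2)` (source edge `e₁`, first dart
  from the midpoint of `e₁` to the midpoint of `s((L-1,1),(L-1,0))`): it is a start corner, and start
  corners are unique (`existsUnique_startCorner`).
* `orbit_six`: in the completed ALL-OPEN configuration the exploration reaches the touch `((L-3,1), 0)` of
  the first free-wall site after six explicit steps (open, open, closed, open, open, closed), with turn
  count `-2`.
* `touch_all`: S5's window step `touch_shift` (four steps, same turn count) iterated along the whole side:
  every free-wall site `w` is touched in the all-open configuration with turn count `-2`.
* `freePhase_of_level`: TouchPhase (`S5.turnCount_touch`) transfers `-2` to every touch in every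
  configuration; `S5.cornerObs_touch_out/in` evaluate the two flux corners and `S5.touch_iff` identifies the
  touch event with `{w ↔ A}`; hole-freeness from `holeFree_innerFaces`.
* `stub_anchorFreePhase`: the registered one-line form (`δ ≤ 1/8`, `L` from `AnchorLattice.exists_level`).
-/

noncomputable section

namespace Summit.CriticalPhenomena.CardyFormulaZ2.Theorems.ParafermionFamiliesToSLESix.StripAnchored

open MeasureTheory Filter Set Metric
open scoped Topology BigOperators
open Literature.Probability.LatticeModels
open Literature.Probability.Percolation (bondPercolation half BondConfig)
open Literature.Probability.RandomPlanarGeometry (DobrushinDomain)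
open Summit.CriticalPhenomena.CardyFormulaZ2.Theorems.ParafermionPrecompact.Negative (IsFamily VanishesOn)
open Summit.CriticalPhenomena.CardyFormulaZ2.Cruxes.EdgePrecompact.QkzStripBoundaryArm (cornerObs)
open Literature.Probability.LatticeModels.DiscreteDobrushin (startCorner exitTime isStartCorner_startCorner
  isInnerFace_of_lt_exitTime not_isInnerFace_exitTime)
open S5 (anchorDomain)
open S2 (sixthPhase)

namespace AnchorFree

/-! ## Two generic orbit steps -/

/-- **One step of the exploration along an open target edge**: from the dart `orb n = (v, k)` (`n < T`)
whose target edge `s(v, v + u_{k+1})` is open, the next dart is `(v + u_{k+1}, k + 3)`; if its face is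
inner it comes before the exit, and the turn count drops by one (a right turn). [cite: Smirnov2001, §2] -/
theorem step_open {E : DiscreteDobrushin} (hE : E.IsZdAdmissible) {ω : BondConfig (Site 2)} {n : ℕ}
    {v v' : Site 2} {k k' : Fin 4} (hn : n < exitTime hE ω)
    (h : cornerOrbit (E.bcBondConfig ω) (startCorner hE) n = (v, k)) (hopen : cTgt (v, k) ∈ E.bcBondConfig ω)
    (hv' : v + cornerUnit (k + 1) = v') (hk' : k + 3 = k') (hin : E.IsInnerFace (cFace (v', k'))) :
    n + 1 < exitTime hE ω ∧ cornerOrbit (E.bcBondConfig ω) (startCorner hE) (n + 1) = (v', k') ∧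
      turnCount (E.bcBondConfig ω) (startCorner hE) (n + 1) =
        turnCount (E.bcBondConfig ω) (startCorner hE) n - 1 := by
  have h1 : cornerOrbit (E.bcBondConfig ω) (startCorner hE) (n + 1) = (v', k') := by
    rw [cornerOrbit_succ, h, nextCorner_of_mem hopen]
    exact Prod.ext hv' hk'
  refine ⟨S5.succ_lt_exitTime hE hn (by rw [h1]; exact hin), h1, ?_⟩
  rw [turnCount_succ, h, turnSign_of_mem hopen]; ring

/-- **One step of the exploration across a closed target edge**: from the dart `orb n = (v, k)` (`n < T`)
whose target edge is closed, the next dart is `(v, k + 1)`; if its face is inner it comes before the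
exit, and the turn count rises by one (a left turn). [cite: Smirnov2001, §2] -/
theorem step_closed {E : DiscreteDobrushin} (hE : E.IsZdAdmissible) {ω : BondConfig (Site 2)} {n : ℕ}
    {v : Site 2} {k k' : Fin 4} (hn : n < exitTime hE ω)
    (h : cornerOrbit (E.bcBondConfig ω) (startCorner hE) n = (v, k)) (hclosed : cTgt (v, k) ∉ E.bcBondConfig ω)
    (hk' : k + 1 = k') (hin : E.IsInnerFace (cFace (v, k'))) :
    n + 1 < exitTime hE ω ∧ cornerOrbit (E.bcBondConfig ω) (startCorner hE) (n + 1) = (v, k') ∧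
      turnCount (E.bcBondConfig ω) (startCorner hE) (n + 1) =
        turnCount (E.bcBondConfig ω) (startCorner hE) n + 1 := by
  have h1 : cornerOrbit (E.bcBondConfig ω) (startCorner hE) (n + 1) = (v, k') := by
    rw [cornerOrbit_succ, h, nextCorner_of_not_mem hclosed]
    exact Prod.ext rfl hk'
  refine ⟨S5.succ_lt_exitTime hE hn (by rw [h1]; exact hin), h1, ?_⟩
  rw [turnCount_succ, h, turnSign_of_not_mem hclosed]

/-- `v - e₀` is a lattice neighbour of `v`. [folklore] -/
theorem adj_sub_unit_zero (v : Site 2) : (zdGraph 2).Adj v (v - cornerUnit 0) := by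
  have : v - cornerUnit 0 = v + cornerUnit 2 := by
    ext i; fin_cases i <;> simp [sub_eq_add_neg]
  rw [this]; exact zdGraph_adj_add_cornerUnit v 2

/-! ## The lattice geometry of the concrete anchor data at level `L` -/

variable {δ : ℝ} {L : ℤ}

section Level

variable (hδ : 0 < δ) (hLδ : (L : ℝ) * δ < 2) (hL1 : 2 ≤ ((L : ℝ) + 1) * δ) (hL : 4 ≤ L)
include hδ hLδ hL1 hL

omit hL in
/-- The inner faces of the anchor data, in coordinates. [folklore] -/
theorem face_iff (f : Site 2) : (anchorData δ).IsInnerFace f ↔ |f 0 + f 1 + 1| < L ∧ |f 0 - f 1| < L :=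
  S5.isInnerFace_anchor_iff (E := anchorData δ) rfl rfl hδ hLδ hL1 f

omit hL in
/-- The inner faces of the anchor data, linearly. [folklore] -/
theorem face_of {f : Site 2}
    (h : f 0 + f 1 + 1 < L ∧ -L < f 0 + f 1 + 1 ∧ f 0 - f 1 < L ∧ -L < f 0 - f 1) :
    (anchorData δ).IsInnerFace f := by
  rw [face_iff hδ hLδ hL1, abs_lt, abs_lt]; omega

/-- Sites of the free window are on the arc `B`, linearly. [folklore] -/
theorem memB_of {v : Site 2}
    (h : L - 1 ≤ v 0 + v 1 ∧ v 0 + v 1 ≤ L ∧ v 0 - v 1 ≤ L - 3 ∧ -(L - 3) ≤ v 0 - v 1) :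
    v ∈ (anchorData δ).zdArcB := by
  rw [AnchorLattice.mem_zdArcB_iff hδ hLδ hL1 hL, abs_le]; omega

/-- Sites below the boundary layer are off the arc `A`, linearly. [folklore] -/
theorem notA_of {v : Site 2}
    (h : v 0 + v 1 < L - 1 ∧ -(L - 1) < v 0 + v 1 ∧ v 0 - v 1 < L - 1 ∧ -(L - 1) < v 0 - v 1) :
    v ∉ (anchorData δ).zdArcA := by
  intro hA
  have hbd := (S5.mem_zdBoundary_anchor_iff (E := anchorData δ) rfl rfl hδ (by omega) hLδ hL1 v).1
    ((anchorData δ).zdArcA_subset_zdBoundary hA)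
  rw [le_abs, le_abs] at hbd
  omega

/-- **Open edges of the completed all-open configuration**: a lattice edge between two sites of the
diamond off the free window is open in `(anchorData δ).bcBondConfig Set.univ` (written linearly: each
endpoint has level `< L - 1` or column `> L - 3` in absolute value). [cite: Smirnov2001, §2] -/
theorem open_of {x y : Site 2} (hxy : (zdGraph 2).Adj x y)
    (hx : (x 0 + x 1 ≤ L ∧ -L ≤ x 0 + x 1 ∧ x 0 - x 1 ≤ L ∧ -L ≤ x 0 - x 1) ∧
      (x 0 + x 1 < L - 1 ∨ L - 3 < x 0 - x 1 ∨ x 0 - x 1 < -(L - 3)))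
    (hy : (y 0 + y 1 ≤ L ∧ -L ≤ y 0 + y 1 ∧ y 0 - y 1 ≤ L ∧ -L ≤ y 0 - y 1) ∧
      (y 0 + y 1 < L - 1 ∨ L - 3 < y 0 - y 1 ∨ y 0 - y 1 < -(L - 3))) :
    s(x, y) ∈ (anchorData δ).bcBondConfig Set.univ := by
  rw [DiscreteDobrushin.mem_bcBondConfig_iff]
  refine ⟨(SimpleGraph.mem_edgeSet _).2 ((AnchorLattice.adj_iff hδ hLδ hL1).2 ⟨hxy, ?_, ?_⟩),
    Or.inr ⟨Set.mem_univ _, fun z hz => ?_⟩⟩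
  · rw [abs_le, abs_le]; omega
  · rw [abs_le, abs_le]; omega
  · rw [AnchorLattice.mem_zdArcB_iff hδ hLδ hL1 hL, abs_le]
    rcases Sym2.mem_iff.1 hz with rfl | rfl <;> omega

/-- The target edge of a corner `(v, k)` is open in the completed all-open configuration when `v` and
`v + u_{k+1}` are sites of the diamond off the free window. [cite: Smirnov2001, §2] -/
theorem open_tgt {v : Site 2} {k : Fin 4}
    (hx : (v 0 + v 1 ≤ L ∧ -L ≤ v 0 + v 1 ∧ v 0 - v 1 ≤ L ∧ -L ≤ v 0 - v 1) ∧
      (v 0 + v 1 < L - 1 ∨ L - 3 < v 0 - v 1 ∨ v 0 - v 1 < -(L - 3)))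
    (hy : ((v + cornerUnit (k + 1)) 0 + (v + cornerUnit (k + 1)) 1 ≤ L ∧
        -L ≤ (v + cornerUnit (k + 1)) 0 + (v + cornerUnit (k + 1)) 1 ∧
        (v + cornerUnit (k + 1)) 0 - (v + cornerUnit (k + 1)) 1 ≤ L ∧
        -L ≤ (v + cornerUnit (k + 1)) 0 - (v + cornerUnit (k + 1)) 1) ∧
      ((v + cornerUnit (k + 1)) 0 + (v + cornerUnit (k + 1)) 1 < L - 1 ∨
        L - 3 < (v + cornerUnit (k + 1)) 0 - (v + cornerUnit (k + 1)) 1 ∨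
        (v + cornerUnit (k + 1)) 0 - (v + cornerUnit (k + 1)) 1 < -(L - 3))) :
    cTgt (v, k) ∈ (anchorData δ).bcBondConfig Set.univ :=
  open_of hδ hLδ hL1 hL (zdGraph_adj_add_cornerUnit v (k + 1)) hx hy

/-- The target edge of a corner `(v, k)` is closed in every completed configuration when `v + u_{k+1}`
is a site of the free window. [cite: Smirnov2001, §2] -/
theorem closed_tgt {v : Site 2} {k : Fin 4} (ω : BondConfig (Site 2))
    (hy : L - 1 ≤ (v + cornerUnit (k + 1)) 0 + (v + cornerUnit (k + 1)) 1 ∧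
      (v + cornerUnit (k + 1)) 0 + (v + cornerUnit (k + 1)) 1 ≤ L ∧
      (v + cornerUnit (k + 1)) 0 - (v + cornerUnit (k + 1)) 1 ≤ L - 3 ∧
      -(L - 3) ≤ (v + cornerUnit (k + 1)) 0 - (v + cornerUnit (k + 1)) 1) :
    cTgt (v, k) ∉ (anchorData δ).bcBondConfig ω :=
  DiscreteDobrushin.not_mem_bcBondConfig_of_mem_zdArcB (AnchorLattice.isZdAdmissible hδ hLδ hL1 hL)
    (Sym2.mem_mk_right _ _) (memB_of hδ hLδ hL1 hL hy)

/-! ## The start corner -/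

/-- **The start corner of the anchor data is `((L-1,1), 2)`**: its vertex `(L-1,1)` is on the arc `A`
(level `L`, column `L - 2`), the other endpoint `(L-2,1)` of its source edge `e₁` is on the arc `B`, its
face `(L-2,0)` is inner and the other face `(L-2,1)` of `e₁` is not; start corners are unique.
[cite: Smirnov2001, §2] -/
theorem startCorner_eq (hE : (anchorData δ).IsZdAdmissible) :
    startCorner hE = ((![L - 1, 1] : Site 2), (2 : Fin 4)) := by
  have h := isStartCorner_startCorner hE
  refine (DiscreteDobrushin.existsUnique_startCorner hE).unique ⟨h.mem_zdArcA, h.mem_zdArcB, h.isOutEdge⟩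
    ⟨?_, ?_, ?_, ?_⟩
  · rw [AnchorLattice.mem_zdArcA_iff hδ hLδ hL1 hL,
      S5.mem_zdBoundary_anchor_iff (E := anchorData δ) rfl rfl hδ (by omega) hLδ hL1]
    simp only [Matrix.cons_val_zero, Matrix.cons_val_one, Matrix.cons_val_fin_one, abs_le, le_abs']
    omega
  · exact memB_of hδ hLδ hL1 hL (by simp; omega)
  · exact face_of hδ hLδ hL1 (by simp [faceAt]; omega)
  · rw [face_iff hδ hLδ hL1]
    simp [faceAt, abs_lt]

/-! ## The first six steps of the all-open exploration -/

variable (hE : (anchorData δ).IsZdAdmissible)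

/-- **Six explicit steps.** In the completed all-open configuration the exploration of the anchor data
goes `((L-1,1),2) → ((L-1,0),1) → ((L-2,0),0) → ((L-2,0),1) → ((L-3,0),0) → ((L-3,1),3) → ((L-3,1),0)`
(follow `s((L-1,1),(L-1,0))`, follow `s((L-1,0),(L-2,0))`, cross the closed `s((L-2,0),(L-2,1))` at the
`B`-site `(L-2,1)`, follow `s((L-2,0),(L-3,0))`, follow `s((L-3,0),(L-3,1))`, cross the closed
`s((L-3,1),(L-2,1))`), all before the exit; the turn counts are `0,-1,-2,-1,-2,-3,-2`. [cite: Smirnov2001, §2] -/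
theorem orbit_six : 6 < exitTime hE Set.univ ∧
    cornerOrbit ((anchorData δ).bcBondConfig Set.univ) (startCorner hE) 6 = ((![L - 3, 1] : Site 2), 0) ∧
      turnCount ((anchorData δ).bcBondConfig Set.univ) (startCorner hE) 6 = -2 := by
  have h0 : cornerOrbit ((anchorData δ).bcBondConfig Set.univ) (startCorner hE) 0 =
      ((![L - 1, 1] : Site 2), 2) := by
    rw [cornerOrbit_zero, startCorner_eq hδ hLδ hL1 hL hE]
  have hT0 : 0 < exitTime hE Set.univ := DiscreteDobrushin.exitTime_pos hE _
  -- step 1: follow `s((L-1,1),(L-1,0))`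
  obtain ⟨hT1, h1, htc1⟩ := step_open hE (v' := ![L - 1, 0]) (k' := 1) hT0 h0
    (open_tgt hδ hLδ hL1 hL (by simp; omega) (by simp; omega)) (by ext i; fin_cases i <;> simp) rfl
    (face_of hδ hLδ hL1 (by simp [cFace, faceAt]; omega))
  -- step 2: follow `s((L-1,0),(L-2,0))`
  obtain ⟨hT2, h2, htc2⟩ := step_open hE (v' := ![L - 2, 0]) (k' := 0) hT1 h1
    (open_tgt hδ hLδ hL1 hL (by simp; omega) (by simp; omega)) (by ext i; fin_cases i <;> simp; omega) rfl
    (face_of hδ hLδ hL1 (by simp [cFace, faceAt]; omega))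
  -- step 3: cross the closed `s((L-2,0),(L-2,1))`
  obtain ⟨hT3, h3, htc3⟩ := step_closed hE (k' := 1) hT2 h2 (closed_tgt hδ hLδ hL1 hL _ (by simp; omega)) rfl
    (face_of hδ hLδ hL1 (by simp [cFace, faceAt]; omega))
  -- step 4: follow `s((L-2,0),(L-3,0))`
  obtain ⟨hT4, h4, htc4⟩ := step_open hE (v' := ![L - 3, 0]) (k' := 0) hT3 h3
    (open_tgt hδ hLδ hL1 hL (by simp; omega) (by simp; omega)) (by ext i; fin_cases i <;> simp; omega) rfl
    (face_of hδ hLδ hL1 (by simp [cFace, faceAt]; omega))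
  -- step 5: follow `s((L-3,0),(L-3,1))`
  obtain ⟨hT5, h5, htc5⟩ := step_open hE (v' := ![L - 3, 1]) (k' := 3) hT4 h4
    (open_tgt hδ hLδ hL1 hL (by simp; omega) (by simp; omega)) (by ext i; fin_cases i <;> simp) rfl
    (face_of hδ hLδ hL1 (by simp [cFace, faceAt]; omega))
  -- step 6: cross the closed `s((L-3,1),(L-2,1))`
  obtain ⟨hT6, h6, htc6⟩ := step_closed hE (k' := 0) hT5 h5 (closed_tgt hδ hLδ hL1 hL _ (by simp; omega)) rfl
    (face_of hδ hLδ hL1 (by simp [cFace, faceAt]; omega))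
  refine ⟨hT6, h6, ?_⟩
  rw [htc6, htc5, htc4, htc3, htc2, htc1, turnCount_zero]; norm_num

/-! ## Along the whole free side -/

/-- **Every free-wall site is touched in the all-open configuration, with turn count `-2`.** By
induction on `m`, the site of level `L - 2` and column `L - 4 - 2m ≥ -(L - 4)` is a dart `(w, 0)` of the
all-open exploration with turn count `-2`: for `m = 0` this is `orbit_six`; the step is S5's window step
`touch_shift` at the previous site `w' = w + e₀ - e₁` (four steps: cross `s(w', w' + e₁)` at the
`B`-site `w' + e₁ = w + e₀`, follow the open edges `s(w', w' - e₀)`, `s(w' - e₀, w)`, cross `s(w, w + e₀)`;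
turns `+1, -1, -1, +1`, same turn count). [cite: Smirnov2010, proof of Lemma 4.5] -/
theorem touch_all (m : ℕ) : ∀ w : Site 2, w 0 + w 1 = L - 2 → w 0 - w 1 + 2 * m = L - 4 →
    -(L - 4) ≤ w 0 - w 1 → ∃ n < exitTime hE Set.univ,
      cornerOrbit ((anchorData δ).bcBondConfig Set.univ) (startCorner hE) n = (w, 0) ∧
        turnCount ((anchorData δ).bcBondConfig Set.univ) (startCorner hE) n = -2 := by
  induction m with
  | zero =>
    intro w hs hd _
    push_cast at hd
    obtain ⟨h6, horb, htc⟩ := orbit_six hδ hLδ hL1 hL hE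
    obtain rfl : w = ![L - 3, 1] := Site.eq_iff_two.2 ⟨by simp; omega, by simp; omega⟩
    exact ⟨6, h6, horb, htc⟩
  | succ m ih =>
    intro w hs hd hd'
    push_cast at hd
    -- the previous free-wall site `w' = w + e₀ - e₁`, one window step to the right
    obtain ⟨n, hn, h, htc⟩ := ih (w + cornerUnit 0 - cornerUnit 1) (by simp; omega) (by simp; omega)
      (by simp; omega)
    obtain ⟨hn4, h4, htc4⟩ := S5.touch_shift hE (w := w + cornerUnit 0 - cornerUnit 1)
      (face_of hδ hLδ hL1 (by simp; omega)) (memB_of hδ hLδ hL1 hL (by simp; omega))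
      (face_of hδ hLδ hL1 (by simp; omega)) hn h
      (open_of hδ hLδ hL1 hL (adj_sub_unit_zero _) (by simp; omega) (by simp; omega))
      (open_of hδ hLδ hL1 hL (zdGraph_adj_add_cornerUnit _ 1) (by simp; omega) (by simp; omega))
    have hw : w + cornerUnit 0 - cornerUnit 1 - cornerUnit 0 + cornerUnit 1 = w := by abel
    rw [hw] at h4
    exact ⟨n + 4, hn4, h4, htc4.trans htc⟩

include hE in
/-- **The absolute free phases at level `L`.** For every free-wall site `w` (level `L - 2`, `|d| ≤ L - 4`)
of the anchor data: `G(w, w - e₀) = sixthPhase (-1) · P(w ↔ A)` and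
`G(w, w - e₁) = sixthPhase (-3) · P(w ↔ A)`. The all-open touch of `w` has turn count `-2` (`touch_all`);
TouchPhase (`S5.turnCount_touch`, hole-free inner faces by `holeFree_innerFaces`) transfers `-2` to every
touch of `w` in every configuration; the two flux darts are then `sixthPhase (-2 ± 1) · P(touch)`
(`S5.cornerObs_touch_out/in`) and `{touch} = {w ↔ A}` (`S5.touch_iff`).
[cite: DuminilCopin2012Parafermion, Proposition 5] -/
theorem freePhase_of_level {w : Site 2} (hs : w 0 + w 1 = L - 2) (hd : |w 0 - w 1| ≤ L - 4) :
    cornerObs (anchorData δ) δ w (w - cornerUnit 0) = sixthPhase (-1) *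
        (((bondPercolation (zdGraph 2) half).real
          {ω : BondConfig (Site 2) | ∃ a ∈ (anchorData δ).zdArcA,
            (SimpleGraph.fromEdgeSet ((anchorData δ).bcBondConfig ω)).Reachable w a} : ℝ) : ℂ) ∧
      cornerObs (anchorData δ) δ w (w - cornerUnit 1) = sixthPhase (-3) *
        (((bondPercolation (zdGraph 2) half).real
          {ω : BondConfig (Site 2) | ∃ a ∈ (anchorData δ).zdArcA,
            (SimpleGraph.fromEdgeSet ((anchorData δ).bcBondConfig ω)).Reachable w a} : ℝ) : ℂ) := by
  rw [abs_le] at hd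
  have hH : HoleFree {f : Site 2 | (anchorData δ).IsInnerFace f} :=
    holeFree_innerFaces anchorDomain.toJordanDomain rfl hδ
  -- the all-open touch of `w`, with turn count `-2`
  obtain ⟨m, hm⟩ := Int.eq_ofNat_of_zero_le (show (0 : ℤ) ≤ w 1 - 1 by omega)
  obtain ⟨n₁, hn₁, h₁, htc₁⟩ := touch_all hδ hLδ hL1 hL hE m w hs (by omega) (by omega)
  -- the free-wall structure of `w`
  have hw : (anchorData δ).IsInnerFace w := face_of hδ hLδ hL1 (by omega)
  have hw' : ¬ (anchorData δ).IsInnerFace (w + cornerUnit 0) := by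
    rw [face_iff hδ hLδ hL1, abs_lt]; simp; omega
  have hu : w + cornerUnit 0 + cornerUnit 1 ∈ (anchorData δ).zdArcB := memB_of hδ hLδ hL1 hL (by simp; omega)
  have hw1 : (anchorData δ).IsInnerFace (w - cornerUnit 0) := face_of hδ hLδ hL1 (by simp; omega)
  have hB0 : w + cornerUnit 0 ∈ (anchorData δ).zdArcB := memB_of hδ hLδ hL1 hL (by simp; omega)
  have hB1 : w + cornerUnit 1 ∈ (anchorData δ).zdArcB := memB_of hδ hLδ hL1 hL (by simp; omega)
  have hwA : w ∉ (anchorData δ).zdArcA := notA_of hδ hLδ hL1 hL (by omega)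
  -- TouchPhase: every touch of `w` has turn count `-2`
  have hτ : ∀ (ω : BondConfig (Site 2)) (n : ℕ), n < exitTime hE ω →
      cornerOrbit ((anchorData δ).bcBondConfig ω) (startCorner hE) n = (w, 0) →
      turnCount ((anchorData δ).bcBondConfig ω) (startCorner hE) n = -2 :=
    fun ω n hn h => by rw [← htc₁]; exact S5.turnCount_touch hE hH hw hw' hu hn hn₁ h h₁
  -- the two flux darts, on the event `{touch} = {w ↔ A}`
  have hset : {ω : BondConfig (Site 2) | ∃ n < exitTime hE ω,
      cornerOrbit ((anchorData δ).bcBondConfig ω) (startCorner hE) n = (w, 0)} =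
      {ω : BondConfig (Site 2) | ∃ a ∈ (anchorData δ).zdArcA,
        (SimpleGraph.fromEdgeSet ((anchorData δ).bcBondConfig ω)).Reachable w a} :=
    Set.ext fun ω => S5.touch_iff hE hH hw hw' hu
  have h1 := S5.cornerObs_touch_out hE hw hw1 hB0 hB1 hwA (-2) hτ
  have h2 := S5.cornerObs_touch_in hE hw hw1 hB0 hB1 hwA (-2) hτ
  rw [hset] at h1 h2
  rw [show (-2 : ℤ) + 1 = -1 by norm_num] at h1
  rw [show (-2 : ℤ) - 1 = -3 by norm_num] at h2
  exact ⟨h1, h2⟩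

end Level

end AnchorFree

/-- **Registered sub-goal `stub_anchorFreePhase`** (of the stub `stub_anchorMoment_of_IP`, line
`strip-anchored-vertex-normalisation`, skeleton r4): for `0 < δ ≤ 1/8` there is a level `L`
(`L δ < 2 ≤ (L + 1) δ`) such that every free-wall site `w` of the concrete anchor data `anchorData δ` (level
`L - 2`, `|w₀ - w₁| ≤ L - 4`) has the ABSOLUTE flux-corner phases
`G(w, w - e₀) = sixthPhase (-1) · P(w ↔ A)`, `G(w, w - e₁) = sixthPhase (-3) · P(w ↔ A)` (S5's wall package
with `τ = -2`, on the full free side).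
[cite: DuminilCopin2012Parafermion, Proposition 5] -/
theorem stub_anchorFreePhase : ∀ δ : ℝ, 0 < δ → δ ≤ 1 / 8 → ∃ L : ℤ, (L : ℝ) * δ < 2 ∧ 2 ≤ ((L : ℝ) + 1) * δ ∧ ∀ w : Site 2, w 0 + w 1 = L - 2 → |w 0 - w 1| ≤ L - 4 → cornerObs (anchorData δ) δ w (w - cornerUnit 0) = sixthPhase (-1) * (((bondPercolation (zdGraph 2) half).real {ω : BondConfig (Site 2) | ∃ a ∈ (anchorData δ).zdArcA, (SimpleGraph.fromEdgeSet ((anchorData δ).bcBondConfig ω)).Reachable w a} : ℝ) : ℂ) ∧ cornerObs (anchorData δ) δ w (w - cornerUnit 1) = sixthPhase (-3) * (((bondPercolation (zdGraph 2) half).real {ω : BondConfig (Site 2) | ∃ a ∈ (anchorData δ).zdArcA, (SimpleGraph.fromEdgeSet ((anchorData δ).bcBondConfig ω)).Reachable w a} : ℝ) : ℂ) := by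
  intro δ hδ hδ8
  obtain ⟨L, hL7, hLδ, hL1⟩ := AnchorLattice.exists_level hδ (hδ8.trans (by norm_num))
  exact ⟨L, hLδ, hL1, fun w hs hd => AnchorFree.freePhase_of_level hδ hLδ hL1 (by omega)
    (AnchorLattice.isZdAdmissible hδ hLδ hL1 (by omega)) hs hd⟩

end Summit.CriticalPhenomena.CardyFormulaZ2.Theorems.ParafermionFamiliesToSLESix.StripAnchored

end
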